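import Summits.QuantumFields.BalabanUV.Beta.GAN24.LatticeKernelConvolutionZero
import Summits.QuantumFields.BalabanUV.Beta.GAN24.StripRegularBiLoc

/-!
# `BalabanUV.Beta.GAN24.LatticeKernelConvolutionTwo` — binder row G-an2-4 / (CONV-C), STENCIL slot, campaign «E3Shape» (`SKELETON-S3.md` node S3-L1,
# ANALYSIS HALF, part 2b): THE MIXED PRODUCT THEOREM `Σ'_w K[A](x − w) · K₂[V](w, y) = K₂[A·V](x, y)` for a one-momentum factor against leaf-14's
# TWO-MOMENTUM kernel `StripRegularBiLoc.latticeKernel₂`, via the partial kernel `p ↦ K[V(p,·)](y)` — strip regular of half-width ZERO (continuous,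
# periodic, bounded on the real zone) with a summable kernel, NO holomorphy of parametric integrals

NOT IN PRINT; OUR BOOKKEEPING (engine «LK-CONV*» part 2b, CLAIMS l.4153 ∕ l.4206; row owner gan24-p1-g3 RULINGS-2 l.4221 «part 2 (mixed∕diagonal forms on
leaf-14's `latticeKernel₂`) … one writer = you»; unit b2b-balaban-gan24-formalise-leaf-07, gen 9).  HONEST FRAMING (cell contract, verbatim): «discharging
`BetaPertH` makes Bałaban's UV stability UNCONDITIONAL — a real constructive-QFT result; it is NOT the continuum limit and NOT the Clay problem.»  HONEST
DEPENDENCY (verbatim): «continuum YM on T⁴ ⇐ BetaPertH ∧ nine spine estimates (0/9 proved); BetaPertH ⇐ (D1) ∧ (D4) ∧ CAP+tail; G-an2-4 gates asym, D1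
and NE2/3/4.»  [folklore] Fourier analysis on `ℤ^{d+1}`: cites nothing, mints no `def … : Prop`, asserts no statement of Bałaban's, instantiates no wall
binder.  NOT summit progress.

## Why (context only; asserted nowhere below)

S3-L1's sandwich `K_N ∘ V ∘ K_N` has ONE-momentum outer factors around a TWO-momentum insertion `V = K₂[𝒱̂]`.  Composing `K[A]` with `K₂[V]` over
the intermediate site is the one-momentum product theorem applied to the PARTIAL KERNEL `Φ_y(p) = K[V(p,·)](y)`, since leaf-14's Fubini identity
`latticeKernel₂_eq_iterated` reads `K₂[V](w, y) = K[Φ_y](w)`.  `Φ_y` is continuous (dominated convergence), `2π`-periodic on the real zone (first-momentum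
slices of `V`), bounded by the joint bound, with norm-summable kernel (leaf-14's two-momentum decay) — exactly the hypotheses of
`LatticeKernelConvolutionZero.tsum_latticeKernel_mul₀`; no holomorphy of `Φ_y` is needed.

## Contents (all [folklore])
§1 update-form slice accessors (`diff_update`, `sides_update`, `stripRegular_of_update`), `fstC_update_inl2` …, and the PARTIAL SLICES
   **`stripRegular_fst_of_joint`**, **`stripRegular_snd_of_joint`** of a jointly strip-regular `V` at real zone points.
§2 the partial kernel `p ↦ latticeKernel (V p) y`: `continuousOn_pkernel`, `openRect_zero`, **`stripRegular_pkernel : StripRegular (fun p => latticeKernel (V p) y) 0 M`**,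
   **`latticeKernel_pkernel_eq : latticeKernel (fun p => latticeKernel (V p) y) w = latticeKernel₂ V w y`**, `summable_norm_latticeKernel_pkernel`.
§3 **`tsum_latticeKernel_mul_latticeKernel₂ : Σ'_w latticeKernel A (x − w) * latticeKernel₂ V w y = latticeKernel₂ (fun p q => A p * V p q) x y`** (+ summability).
Right-hand form, block swap, diagonal lemma: siblings `LatticeKernelSwap`, `LatticeKernelDiagonal`.  NOT BetaPertH, NOT continuum, NOT Clay.
-/

noncomputable section

open Complex Set MeasureTheory Filter Topology
open Literature.MathematicalPhysics.QuantumFieldTheory.Balaban1983to89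
open B4Strip (ofRealVec Strip reVec)
open B4ContourShift (BZ latticeKernel StripRegular supNorm latticeKernel_decay ofRealVec_mem_Strip openRect closedRect integrand)
open B4TorusKernel (summable_of_decay)
open B5Strip145Analytic (strip_mono)
open Beta.FibreInverseDecay (reVec_mem_BZ)
open Summit.QuantumFields.BalabanUV.Beta.GAN24.LatticeKernelConvolution (stripRegular_nonneg)
open Summit.QuantumFields.BalabanUV.Beta.GAN24.LatticeKernelConvolutionZero (tsum_latticeKernel_mul₀ summable_latticeKernel_mul₀)
open Summit.QuantumFields.BalabanUV.Beta.GAN24.StripRegularRestrict (inl2 inr2 pair pair_inl pair_inr inl2_injective inr2_injective inl2_or_inr2 fstC sndC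
  fstC_apply sndC_apply fstC_pair sndC_pair joint joint_apply joint_pair ofRealVec_pair stripRegular_compFst)
open Summit.QuantumFields.BalabanUV.Beta.GAN24.StripRegularBiLoc (latticeKernel₂ latticeKernel₂_eq_iterated norm_latticeKernel₂_le pair_mem_BZ_iff)
open scoped Real

namespace Summit.QuantumFields.BalabanUV.Beta.GAN24.LatticeKernelConvolutionTwo

variable {d : ℕ}

/-! ## §1 Partial slices of a jointly strip-regular two-momentum symbol -/

section UpdateForm

variable {D : ℕ}

/-- [folklore] pv17's slice point is an update of a real zone point. -/
theorem insertNth_ofRealVec_eq_update (i : Fin (D + 1)) (z : ℂ) (q : Fin D → ℝ) :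
    i.insertNth z (ofRealVec q) = Function.update (ofRealVec (i.insertNth (0 : ℝ) q)) i z := by
  funext k
  refine Fin.succAboveCases i ?_ (fun j => ?_) k
  · rw [Fin.insertNth_apply_same, Function.update_self]
  · rw [Fin.insertNth_apply_succAbove, Function.update_of_ne (Fin.succAbove_ne i j)]
    simp only [ofRealVec, Fin.insertNth_apply_succAbove]

/-- [folklore] conversely, an update of a real point is a slice point through the real base point with that coordinate dropped. -/
theorem update_ofRealVec_eq_insertNth (i : Fin (D + 1)) (z : ℂ) (Q : Fin (D + 1) → ℝ) :
    Function.update (ofRealVec Q) i z = i.insertNth z (ofRealVec fun j => Q (i.succAbove j)) := by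
  funext k
  refine Fin.succAboveCases i ?_ (fun j => ?_) k
  · rw [Fin.insertNth_apply_same, Function.update_self]
  · rw [Fin.insertNth_apply_succAbove, Function.update_of_ne (Fin.succAbove_ne i j)]
    simp only [ofRealVec]

/-- [folklore] inserting a zero coordinate keeps a zone point in the zone. -/
theorem insertNth_zero_mem_BZ (i : Fin (D + 1)) {q : Fin D → ℝ} (hq : q ∈ BZ D) : i.insertNth (0 : ℝ) q ∈ BZ (D + 1) := by
  have h1 : ∀ j, -Real.pi ≤ q j := fun j => hq.1 j
  have h2 : ∀ j, q j ≤ Real.pi := fun j => hq.2 j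
  refine ⟨fun k => ?_, fun k => ?_⟩
  · refine Fin.succAboveCases i ?_ (fun j => ?_) k
    · simp only [Fin.insertNth_apply_same]; linarith [Real.pi_pos]
    · simp only [Fin.insertNth_apply_succAbove]; exact h1 j
  · refine Fin.succAboveCases i ?_ (fun j => ?_) k
    · simp only [Fin.insertNth_apply_same]; linarith [Real.pi_pos]
    · simp only [Fin.insertNth_apply_succAbove]; exact h2 j

/-- [folklore] dropping a coordinate keeps a zone point in the zone. -/
theorem succAbove_mem_BZ (i : Fin (D + 1)) {Q : Fin (D + 1) → ℝ} (hQ : Q ∈ BZ (D + 1)) : (fun j => Q (i.succAbove j)) ∈ BZ D :=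
  ⟨fun j => hQ.1 (i.succAbove j), fun j => hQ.2 (i.succAbove j)⟩

/-- [folklore] ACCESSOR: slice holomorphy of a strip-regular symbol in update form. -/
theorem diff_update {G : (Fin (D + 1) → ℂ) → ℂ} {κ M : ℝ} (h : StripRegular G κ M) (i : Fin (D + 1))
    {Q : Fin (D + 1) → ℝ} (hQ : Q ∈ BZ (D + 1)) :
    DifferentiableOn ℂ (fun z => G (Function.update (ofRealVec Q) i z)) (openRect κ) := by
  have e : (fun z => G (Function.update (ofRealVec Q) i z)) = fun z => G (i.insertNth z (ofRealVec fun j => Q (i.succAbove j))) := by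
    funext z; rw [update_ofRealVec_eq_insertNth]
  rw [e]
  exact h.diff i _ (succAbove_mem_BZ i hQ)

/-- [folklore] ACCESSOR: side matching of a strip-regular symbol in update form. -/
theorem sides_update {G : (Fin (D + 1) → ℂ) → ℂ} {κ M : ℝ} (h : StripRegular G κ M) (i : Fin (D + 1))
    {Q : Fin (D + 1) → ℝ} (hQ : Q ∈ BZ (D + 1)) {y : ℝ} (hy : |y| ≤ κ) :
    G (Function.update (ofRealVec Q) i (-Real.pi + y * I)) = G (Function.update (ofRealVec Q) i (Real.pi + y * I)) := by
  rw [update_ofRealVec_eq_insertNth, update_ofRealVec_eq_insertNth]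
  exact h.sides i _ (succAbove_mem_BZ i hQ) y hy

/-- [folklore] CONSTRUCTOR: strip regularity from slice conditions in update form. -/
theorem stripRegular_of_update {G : (Fin (D + 1) → ℂ) → ℂ} {κ M : ℝ}
    (hc : ContinuousOn G (Strip (D + 1) κ))
    (hd : ∀ (i : Fin (D + 1)) (Q : Fin (D + 1) → ℝ), Q ∈ BZ (D + 1) →
      DifferentiableOn ℂ (fun z => G (Function.update (ofRealVec Q) i z)) (openRect κ))
    (hs : ∀ (i : Fin (D + 1)) (Q : Fin (D + 1) → ℝ), Q ∈ BZ (D + 1) → ∀ y : ℝ, |y| ≤ κ →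
      G (Function.update (ofRealVec Q) i (-Real.pi + y * I)) = G (Function.update (ofRealVec Q) i (Real.pi + y * I)))
    (hb : ∀ p ∈ Strip (D + 1) κ, ‖G p‖ ≤ M) : StripRegular G κ M where
  cont := hc
  diff i q hq := by
    have e : (fun z => G (i.insertNth z (ofRealVec q))) = fun z => G (Function.update (ofRealVec (i.insertNth (0 : ℝ) q)) i z) := by
      funext z; rw [insertNth_ofRealVec_eq_update]
    rw [e]
    exact hd i _ (insertNth_zero_mem_BZ i hq)
  sides i q hq y hy := by
    rw [insertNth_ofRealVec_eq_update, insertNth_ofRealVec_eq_update]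
    exact hs i _ (insertNth_zero_mem_BZ i hq) y hy
  bound := hb

end UpdateForm

section Partial

variable {V : (Fin (d + 1) → ℂ) → (Fin (d + 1) → ℂ) → ℂ} {κ M : ℝ}

/-- [folklore] an `inl2`-index is never an `inr2`-index. -/
theorem inl2_ne_inr2 (i j : Fin (d + 1)) : inl2 i ≠ inr2 j := by
  intro h
  have h' := congrArg Fin.val h
  simp only [inl2, inr2, Fin.val_castAdd, Fin.val_natAdd] at h'
  have := i.isLt
  omega

/-- [folklore] a left update of the joint momentum updates the first momentum. -/
theorem fstC_update_inl2 (P : Fin (d + 1 + d + 1) → ℂ) (i : Fin (d + 1)) (z : ℂ) :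
    fstC (Function.update P (inl2 i) z) = Function.update (fstC P) i z := by
  funext i'
  by_cases h : i' = i
  · subst h; simp only [fstC_apply, Function.update_self]
  · rw [fstC_apply, Function.update_of_ne (inl2_injective.ne h), Function.update_of_ne h, fstC_apply]

/-- [folklore] … and keeps the second. -/
theorem sndC_update_inl2 (P : Fin (d + 1 + d + 1) → ℂ) (i : Fin (d + 1)) (z : ℂ) :
    sndC (Function.update P (inl2 i) z) = sndC P := by
  funext j
  rw [sndC_apply, Function.update_of_ne (inl2_ne_inr2 i j).symm, sndC_apply]

/-- [folklore] a right update updates the second momentum. -/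
theorem sndC_update_inr2 (P : Fin (d + 1 + d + 1) → ℂ) (j : Fin (d + 1)) (z : ℂ) :
    sndC (Function.update P (inr2 j) z) = Function.update (sndC P) j z := by
  funext j'
  by_cases h : j' = j
  · subst h; simp only [sndC_apply, Function.update_self]
  · rw [sndC_apply, Function.update_of_ne (inr2_injective.ne h), Function.update_of_ne h, sndC_apply]

/-- [folklore] … and keeps the first. -/
theorem fstC_update_inr2 (P : Fin (d + 1 + d + 1) → ℂ) (j : Fin (d + 1)) (z : ℂ) :
    fstC (Function.update P (inr2 j) z) = fstC P := by
  funext i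
  rw [fstC_apply, Function.update_of_ne (inl2_ne_inr2 i j), fstC_apply]

/-- [folklore] first momentum of a real joint point. -/
theorem fstC_ofRealVec_pair (P Q : Fin (d + 1) → ℝ) : fstC (ofRealVec (pair P Q)) = ofRealVec P := by
  rw [ofRealVec_pair, fstC_pair]

/-- [folklore] second momentum of a real joint point. -/
theorem sndC_ofRealVec_pair (P Q : Fin (d + 1) → ℝ) : sndC (ofRealVec (pair P Q)) = ofRealVec Q := by
  rw [ofRealVec_pair, sndC_pair]

/-- [folklore] `pair` of strip points is a joint strip point. -/
theorem pair_mem_Strip {p q : Fin (d + 1) → ℂ} (hp : p ∈ Strip (d + 1) κ) (hq : q ∈ Strip (d + 1) κ) :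
    pair p q ∈ Strip (d + 1 + d + 1) κ := fun l => by
  rcases inl2_or_inr2 l with ⟨i, rfl⟩ | ⟨i, rfl⟩ <;> [(rw [pair_inl]; exact hp i); (rw [pair_inr]; exact hq i)]

/-- [folklore] `p ↦ pair p q` is continuous. -/
theorem continuous_pair_left (q : Fin (d + 1) → ℂ) : Continuous fun p : Fin (d + 1) → ℂ => pair p q := by
  refine continuous_pi fun l => ?_
  rcases inl2_or_inr2 l with ⟨i, rfl⟩ | ⟨i, rfl⟩ <;> [(simp only [pair_inl]; exact continuous_apply i); (simp only [pair_inr]; exact continuous_const)]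

/-- [folklore] `q ↦ pair p q` is continuous. -/
theorem continuous_pair_right (p : Fin (d + 1) → ℂ) : Continuous fun q : Fin (d + 1) → ℂ => pair p q := by
  refine continuous_pi fun l => ?_
  rcases inl2_or_inr2 l with ⟨i, rfl⟩ | ⟨i, rfl⟩ <;> [(simp only [pair_inl]; exact continuous_const); (simp only [pair_inr]; exact continuous_apply i)]

/-- [folklore] **FIRST-MOMENTUM SLICES**: a jointly strip-regular `V` is strip regular in `p` at every REAL zone point `q`, same `κ, M`. -/
theorem stripRegular_fst_of_joint (h : StripRegular (joint V) κ M) (hκ : 0 ≤ κ) {q : Fin (d + 1) → ℝ} (hq : q ∈ BZ (d + 1)) :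
    StripRegular (fun p => V p (ofRealVec q)) κ M := by
  have hqS : ofRealVec q ∈ Strip (d + 1) κ := ofRealVec_mem_Strip hκ hq
  refine stripRegular_of_update ?_ ?_ ?_ ?_
  · have e : (fun p => V p (ofRealVec q)) = joint V ∘ fun p => pair p (ofRealVec q) := by
      funext p; simp only [Function.comp_apply, joint_pair]
    rw [e]
    exact h.cont.comp (continuous_pair_left _).continuousOn fun p hp => pair_mem_Strip hp hqS
  · intro i P hP
    have e : (fun z => V (Function.update (ofRealVec P) i z) (ofRealVec q)) =
        fun z => joint V (Function.update (ofRealVec (pair P q)) (inl2 i) z) := by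
      funext z; rw [joint_apply, fstC_update_inl2, sndC_update_inl2, fstC_ofRealVec_pair, sndC_ofRealVec_pair]
    rw [e]
    exact diff_update h (inl2 i) ((pair_mem_BZ_iff P q).mpr ⟨hP, hq⟩)
  · intro i P hP y hy
    have e : ∀ z, V (Function.update (ofRealVec P) i z) (ofRealVec q) = joint V (Function.update (ofRealVec (pair P q)) (inl2 i) z) := by
      intro z; rw [joint_apply, fstC_update_inl2, sndC_update_inl2, fstC_ofRealVec_pair, sndC_ofRealVec_pair]
    rw [e, e]
    exact sides_update h (inl2 i) ((pair_mem_BZ_iff P q).mpr ⟨hP, hq⟩) hy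
  · intro p hp
    have := h.bound (pair p (ofRealVec q)) (pair_mem_Strip hp hqS)
    rwa [joint_pair] at this

/-- [folklore] **SECOND-MOMENTUM SLICES**: a jointly strip-regular `V` is strip regular in `q` at every REAL zone point `p`, same `κ, M`. -/
theorem stripRegular_snd_of_joint (h : StripRegular (joint V) κ M) (hκ : 0 ≤ κ) {p : Fin (d + 1) → ℝ} (hp : p ∈ BZ (d + 1)) :
    StripRegular (fun q => V (ofRealVec p) q) κ M := by
  have hpS : ofRealVec p ∈ Strip (d + 1) κ := ofRealVec_mem_Strip hκ hp
  refine stripRegular_of_update ?_ ?_ ?_ ?_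
  · have e : (fun q => V (ofRealVec p) q) = joint V ∘ fun q => pair (ofRealVec p) q := by
      funext q; simp only [Function.comp_apply, joint_pair]
    rw [e]
    exact h.cont.comp (continuous_pair_right _).continuousOn fun q hq => pair_mem_Strip hpS hq
  · intro j Q hQ
    have e : (fun z => V (ofRealVec p) (Function.update (ofRealVec Q) j z)) =
        fun z => joint V (Function.update (ofRealVec (pair p Q)) (inr2 j) z) := by
      funext z; rw [joint_apply, fstC_update_inr2, sndC_update_inr2, fstC_ofRealVec_pair, sndC_ofRealVec_pair]
    rw [e]
    exact diff_update h (inr2 j) ((pair_mem_BZ_iff p Q).mpr ⟨hp, hQ⟩)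
  · intro j Q hQ y hy
    have e : ∀ z, V (ofRealVec p) (Function.update (ofRealVec Q) j z) = joint V (Function.update (ofRealVec (pair p Q)) (inr2 j) z) := by
      intro z; rw [joint_apply, fstC_update_inr2, sndC_update_inr2, fstC_ofRealVec_pair, sndC_ofRealVec_pair]
    rw [e, e]
    exact sides_update h (inr2 j) ((pair_mem_BZ_iff p Q).mpr ⟨hp, hQ⟩) hy
  · intro q hq
    have := h.bound (pair (ofRealVec p) q) (pair_mem_Strip hpS hq)
    rwa [joint_pair] at this

end Partial

/-! ## §2 The partial kernel `p ↦ K[V(p,·)](y)` -/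

section PartialKernel

variable {V : (Fin (d + 1) → ℂ) → (Fin (d + 1) → ℂ) → ℂ} {κ M : ℝ}

/-- [folklore] the partial kernel is CONTINUOUS on the whole strip (dominated convergence: the integrand is jointly continuous and bounded on
`Strip × zone`). -/
theorem continuousOn_pkernel (h : StripRegular (joint V) κ M) (hκ : 0 ≤ κ) (y : Fin (d + 1) → ℤ) :
    ContinuousOn (fun p => latticeKernel (V p) y) (Strip (d + 1) κ) := by
  have hBZ : MeasurableSet (BZ (d + 1)) := by unfold BZ; exact measurableSet_Icc
  have hvol : volume (BZ (d + 1)) < ⊤ := by unfold BZ; exact measure_Icc_lt_top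
  -- the un-normalised integral is continuous on the strip
  have hF : ContinuousOn (fun P => ∫ q in BZ (d + 1), integrand (V P) y q) (Strip (d + 1) κ) := by
    refine continuousOn_of_dominated (bound := fun _ => M) ?_ ?_ ?_ ?_
    · intro P hP
      refine ContinuousOn.aestronglyMeasurable ?_ hBZ
      have hc : ContinuousOn (fun q : Fin (d + 1) → ℝ => V P (ofRealVec q)) (BZ (d + 1)) := by
        have e : (fun q : Fin (d + 1) → ℝ => V P (ofRealVec q)) = joint V ∘ fun q => pair P (ofRealVec q) := by
          funext q; simp only [Function.comp_apply, joint_pair]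
        rw [e]
        refine h.cont.comp ((continuous_pair_right P).comp B4ContourShift.continuous_ofRealVec).continuousOn fun q hq => ?_
        exact pair_mem_Strip hP (ofRealVec_mem_Strip hκ hq)
      refine hc.mul (Continuous.continuousOn ?_)
      unfold B4ContourShift.phase
      fun_prop
    · intro P hP
      refine ae_restrict_of_forall_mem hBZ fun q hq => ?_
      unfold integrand
      rw [norm_mul, B4ContourShift.norm_cexp_phase, mul_one]
      have := h.bound (pair P (ofRealVec q)) (pair_mem_Strip hP (ofRealVec_mem_Strip hκ hq))
      rwa [joint_pair] at this
    · exact integrableOn_const (hs := hvol.ne)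
    · refine ae_restrict_of_forall_mem hBZ fun q hq => ?_
      have e : (fun P => integrand (V P) y q) = fun P => joint V (pair P (ofRealVec q)) * cexp (I * B4ContourShift.phase q y) := by
        funext P; unfold integrand; rw [joint_pair]
      rw [e]
      refine ContinuousOn.mul ?_ continuousOn_const
      exact h.cont.comp (continuous_pair_left _).continuousOn fun P hP => pair_mem_Strip hP (ofRealVec_mem_Strip hκ hq)
  have e : (fun p => latticeKernel (V p) y) = fun P => (((2 * Real.pi) ^ (d + 1))⁻¹ : ℝ) • ∫ q in BZ (d + 1), integrand (V P) y q := by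
    funext P; rfl
  rw [e]
  exact hF.const_smul (((2 * Real.pi) ^ (d + 1))⁻¹ : ℝ)

/-- [folklore] the open rectangle of half-width `0` is empty (no holomorphy is asked of a half-width-`0` strip-regular symbol). -/
theorem openRect_zero : openRect 0 = (∅ : Set ℂ) := by
  unfold openRect
  rw [neg_zero, Set.Ioo_self, Complex.reProdIm]
  simp

/-- [folklore] on the real zone the partial kernel is bounded by the joint bound (the second-momentum slice decays, `e^{−κ|y|} ≤ 1`). -/
theorem norm_latticeKernel_slice_le (h : StripRegular (joint V) κ M) (hκ : 0 ≤ κ) {p : Fin (d + 1) → ℝ} (hp : p ∈ BZ (d + 1))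
    (y : Fin (d + 1) → ℤ) : ‖latticeKernel (V (ofRealVec p)) y‖ ≤ M := by
  refine (latticeKernel_decay (stripRegular_snd_of_joint h hκ hp) hκ y).trans ?_
  have hM : 0 ≤ M := stripRegular_nonneg (stripRegular_snd_of_joint h hκ hp) hκ
  have : Real.exp (-(κ * supNorm y)) ≤ 1 := Real.exp_le_one_iff.mpr (by nlinarith [B4ContourShift.supNorm_nonneg y, hκ])
  nlinarith

/-- [folklore] a point of the half-width-`0` strip is real. -/
theorem ofRealVec_reVec_of_mem_Strip_zero {P : Fin (d + 1) → ℂ} (hP : P ∈ Strip (d + 1) 0) : ofRealVec (reVec P) = P := by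
  funext μ
  apply Complex.ext
  · simp [ofRealVec, reVec]
  · have h := (hP μ).2
    have h0 : (P μ).im = 0 := abs_nonpos_iff.mp h
    simp [ofRealVec, h0]

/-- [folklore] **THE PARTIAL KERNEL IS STRIP REGULAR OF HALF-WIDTH ZERO** with the joint bound: continuous on the real zone, `2π`-periodic in each
coordinate (from the first-momentum slices of `V`), bounded by `M`; the (empty) holomorphy condition is vacuous. -/
theorem stripRegular_pkernel (h : StripRegular (joint V) κ M) (hκ : 0 ≤ κ) (y : Fin (d + 1) → ℤ) :
    StripRegular (fun p => latticeKernel (V p) y) 0 M where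
  cont := (continuousOn_pkernel h hκ y).mono (strip_mono hκ)
  diff i q hq := by rw [openRect_zero]; exact differentiableOn_empty
  sides i q hq t ht := by
    have ht0 : t = 0 := abs_nonpos_iff.mp ht
    subst ht0
    refine B4Green244.latticeKernel_congr (fun s hs => ?_) y
    exact (stripRegular_fst_of_joint h hκ hs).sides i q hq 0 (by rw [abs_zero]; exact hκ)
  bound P hP := by
    show ‖latticeKernel (V P) y‖ ≤ M
    rw [← ofRealVec_reVec_of_mem_Strip_zero hP]
    exact norm_latticeKernel_slice_le h hκ (reVec_mem_BZ hP) y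

/-- [folklore] **THE LATTICE KERNEL OF THE PARTIAL KERNEL IS THE TWO-MOMENTUM KERNEL** (leaf-14's Fubini, read backwards):
`K[p ↦ K[V p](y)](w) = K₂[V](w, y)`. -/
theorem latticeKernel_pkernel_eq (h : StripRegular (joint V) κ M) (hκ : 0 ≤ κ) (w y : Fin (d + 1) → ℤ) :
    latticeKernel (fun p => latticeKernel (V p) y) w = latticeKernel₂ V w y :=
  (latticeKernel₂_eq_iterated h hκ w y).symm

/-- [folklore] hence its kernel is norm-summable when `κ > 0` (two-momentum decay in the first argument). -/
theorem summable_norm_latticeKernel_pkernel (h : StripRegular (joint V) κ M) (hκ : 0 < κ) (y : Fin (d + 1) → ℤ) :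
    Summable fun w => ‖latticeKernel (fun p => latticeKernel (V p) y) w‖ := by
  have hM : 0 ≤ M := stripRegular_nonneg h hκ.le
  have hdec : ∀ w, ‖latticeKernel (fun p => latticeKernel (V p) y) w‖ ≤ M * Real.exp (-(κ * supNorm w)) := by
    intro w
    rw [latticeKernel_pkernel_eq h hκ.le w y]
    refine (norm_latticeKernel₂_le h hκ.le w y).trans (mul_le_mul_of_nonneg_left (Real.exp_le_exp.mpr ?_) hM)
    have := le_max_left (supNorm w) (supNorm y)
    nlinarith
  exact (summable_of_decay _ hκ hdec).norm

end PartialKernel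

/-! ## §3 The mixed product theorem -/

section Mixed

variable {A : (Fin (d + 1) → ℂ) → ℂ} {V : (Fin (d + 1) → ℂ) → (Fin (d + 1) → ℂ) → ℂ} {κ MA MV : ℝ}

/-- [folklore] the product symbol `A(p)·V(p,q)` is jointly strip regular. -/
theorem stripRegular_joint_mul_left (hA : StripRegular A κ MA) (hV : StripRegular (joint V) κ MV) (hκ : 0 ≤ κ) :
    StripRegular (joint fun p q => A p * V p q) κ (MA * MV) := by
  have h := (stripRegular_compFst hA).mul hV (stripRegular_nonneg hA hκ)
  exact h

/-- [folklore] linearity of the lattice kernel in the symbol: constant multiples (pv09's `B4Green242Bridge.latticeKernel_const_mul`, re-proved to keep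
the import closure small). -/
theorem latticeKernel_const_mul (c : ℂ) (G : (Fin (d + 1) → ℂ) → ℂ) (x : Fin (d + 1) → ℤ) :
    latticeKernel (fun P => c * G P) x = c * latticeKernel G x := by
  unfold latticeKernel B4ContourShift.fourierBox
  have h : integrand (fun P => c * G P) x = fun p => c * integrand G x p := by
    funext p; unfold integrand; ring
  rw [h, integral_const_mul, mul_smul_comm]

/-- [folklore] the partial kernel of the product symbol is `A` times the partial kernel. -/
theorem pkernel_mul_left (A : (Fin (d + 1) → ℂ) → ℂ) (V : (Fin (d + 1) → ℂ) → (Fin (d + 1) → ℂ) → ℂ) (y : Fin (d + 1) → ℤ) :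
    (fun p => latticeKernel ((fun p q => A p * V p q) p) y) = fun p => A p * latticeKernel (V p) y := by
  funext p
  exact latticeKernel_const_mul (A p) (V p) y

/-- [folklore] **THE MIXED PRODUCT THEOREM**: a strip-regular one-momentum factor against the two-momentum kernel of a jointly strip-regular symbol
(`κ > 0`): `Σ'_{w ∈ ℤ^{d+1}} K[A](x − w) · K₂[V](w, y) = K₂[(p,q) ↦ A(p) V(p,q)](x, y)` — the outer-leg composition of S3-L1's sandwich. -/
theorem tsum_latticeKernel_mul_latticeKernel₂ (hA : StripRegular A κ MA) (hV : StripRegular (joint V) κ MV) (hκ : 0 < κ)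
    (x y : Fin (d + 1) → ℤ) :
    ∑' w, latticeKernel A (x - w) * latticeKernel₂ V w y = latticeKernel₂ (fun p q => A p * V p q) x y := by
  have e1 : ∀ w, latticeKernel₂ V w y = latticeKernel (fun p => latticeKernel (V p) y) w := fun w => (latticeKernel_pkernel_eq hV hκ.le w y).symm
  simp_rw [e1]
  rw [tsum_latticeKernel_mul₀ (hA.of_le hκ.le) (stripRegular_pkernel hV hκ.le y) le_rfl (summable_norm_latticeKernel_pkernel hV hκ y) x,
    latticeKernel₂_eq_iterated (stripRegular_joint_mul_left hA hV hκ.le) hκ.le x y, pkernel_mul_left]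

/-- [folklore] summability of the mixed summand. -/
theorem summable_latticeKernel_mul_latticeKernel₂ (hA : StripRegular A κ MA) (hV : StripRegular (joint V) κ MV) (hκ : 0 < κ)
    (x y : Fin (d + 1) → ℤ) :
    Summable fun w => latticeKernel A (x - w) * latticeKernel₂ V w y := by
  have e1 : ∀ w, latticeKernel₂ V w y = latticeKernel (fun p => latticeKernel (V p) y) w := fun w => (latticeKernel_pkernel_eq hV hκ.le w y).symm
  simp_rw [e1]
  exact summable_latticeKernel_mul₀ (hA.of_le hκ.le) le_rfl (summable_norm_latticeKernel_pkernel hV hκ y) x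

end Mixed

end Summit.QuantumFields.BalabanUV.Beta.GAN24.LatticeKernelConvolutionTwo

end
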